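import Summits.CriticalPhenomena.PercolationContinuityZ3.Theorems.SahiMasterFamilyPhiNotEvent
import Summits.CriticalPhenomena.PercolationContinuityZ3.Theorems.SahiMasterFamilyPhiOrbitSeven
import Summits.CriticalPhenomena.PercolationContinuityZ3.Theorems.SahiMasterFamilyEqPrincipal

/-!
# G-systems: the event-side structure that the relaxation `F(k)` forgets — they lie in `X_k` AND in the one-missing-face cone;
# `(GH)_k` for every `k ≤ 7`

Unit `prim-masterthm-p4` (gen 15; crux anchor stmt-CriticalPhenomena-4575, helper work; memo
`run/shared/lean/prim/prim-masterthm/prim-masterthm-p4/P4-GEN15-REPORT.md` §2, §5).  Companions: `…PrincipalCapBeta` (`phiSet`, `PhiNonneg`),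
`…PhiSymmetric` / `…PhiSymmetricLift` (`¬ PhiNonneg k` for `k ≥ 16`), `…PhiSecondOrder`, `…PhiNotEvent` (face inequality in expectation).

A **G-SYSTEM** of order `k` on a finite product space `μ_p` is a family of INCREASING events `(G_S)_{S ⊆ [k]}` with
`G_S ∩ G_T ⊆ G_{S∪T}` ("union property") — equivalently a monotone map `ω ↦ 𝒢(ω) := {S : ω ∈ G_S}` into UNION-CLOSED families; it is
NORMALISED if `G_{[k]}` is everything.  Its moment function is `β_S := μ_p(G_S)`.  Memo §2 (paper): every principal-cap family of increasing
events induces a normalised G-system with the same `β` (`G_S = {ω : ω with the cores of S opened ∈ ⋂_{i∈S} U_i}`), and conversely every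
normalised G-system is the `η → 0` limit of principal-cap families (cores `~ Bernoulli(η)`), so that
**(GH)_k ["`Φ_k(β) ≥ 0` for every normalised G-system"] ⟺ PC-k [Sahi's `C_k` on the principal-cap stratum]** for every `k`.

THIS FILE (no new definitions; hypotheses inline):
* `gsystem_supermul`: `β_S β_T ≤ β_{S∪T}` (Harris + union property) and `gsystem_nonneg/le_one/univ` — G-systems lie in `X_k`, so
  `phiSet_gsystem_nonneg_of_phiNonneg`: `F(k) ⇒ (GH)_k`;
* `gsystem_face`: **`Σ_{i∈B} β_{B∖i} ≤ 1 + (|B|−1)·β_B`** (the one-missing-face inequalities, via `PhiNotEvent.sum_ex_indicator_erase_le`) — NOT implied by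
  `X_k` and violated by the order-16 witness against `F(16)`; hence `gsystem_ne_f16`: no G-system of order 16 has the witness as moment function;
* **`phiSet_gsystem_nonneg_of_le_seven`: `(GH)_k` holds for `3 ≤ k ≤ 7`** (from the kernel theorems `F(3),…,F(7)` of gens 13), for every finite
  product space.
HONEST FRAMING: `(GH)_k` = PC-k is OPEN for `k ≥ 8`; `F(k)` cannot decide it from `k = 16` on.  Sahi's `C_k`, Kahn's Conjecture 5 and the master
theorem remain OPEN.  Axioms standard. [this work]
-/

noncomputable section

open scoped Classical

namespace Summit.CriticalPhenomena.PercolationContinuityZ3.Theorems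

namespace GSystems

open Finset
open Literature.Combinatorics.Sahi2008
open Literature.Probability.Percolation.DecisionTree (ind ind_of_mem ind_of_not_mem ind_nonneg)
open PrincipalCapBeta (phiSet)

variable {ι : Type} [Fintype ι] {k : ℕ}

/-- Moments of a G-system are nonnegative. [this work] -/
theorem gsystem_nonneg (p : ι → unitInterval) (G : Finset (Fin k) → Set (Set ι)) (S : Finset (Fin k)) :
    0 ≤ ex (bernoulliWeight p) (ind (G S)) :=
  ex_nonneg (fun ω => (isFKGMeasure_bernoulliWeight p).nonneg ω) fun ω => ind_nonneg _ ω

/-- Moments of a G-system are at most one. [this work] -/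
theorem gsystem_le_one (p : ι → unitInterval) (G : Finset (Fin k) → Set (Set ι)) (S : Finset (Fin k)) :
    ex (bernoulliWeight p) (ind (G S)) ≤ 1 := by
  have h := ex_mono (μ := bernoulliWeight p) (fun ω => (isFKGMeasure_bernoulliWeight p).nonneg ω)
    (f := ind (G S)) (g := fun _ => (1 : ℝ)) fun ω => by
      by_cases hω : ω ∈ G S
      · rw [ind_of_mem hω]
      · rw [ind_of_not_mem hω]; exact zero_le_one
  rwa [ex_const (isFKGMeasure_bernoulliWeight p).sum_eq_one] at h

/-- A normalised G-system has top moment one. [this work] -/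
theorem gsystem_univ (p : ι → unitInterval) (G : Finset (Fin k) → Set (Set ι)) (htop : G univ = Set.univ) :
    ex (bernoulliWeight p) (ind (G univ)) = 1 := by
  rw [htop, ind_univ_eq_one]
  exact ex_const (isFKGMeasure_bernoulliWeight p).sum_eq_one 1

/-- **Supermultiplicativity of G-system moments**: `β_S β_T ≤ β_{S∪T}` (Harris for the increasing events `G_S, G_T`, then the union property
`G_S ∩ G_T ⊆ G_{S∪T}`). [this work] -/
theorem gsystem_supermul (p : ι → unitInterval) (G : Finset (Fin k) → Set (Set ι)) (hup : ∀ S, IsUpperSet (G S))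
    (hG : ∀ S T, G S ∩ G T ⊆ G (S ∪ T)) (S T : Finset (Fin k)) :
    ex (bernoulliWeight p) (ind (G S)) * ex (bernoulliWeight p) (ind (G T)) ≤ ex (bernoulliWeight p) (ind (G (S ∪ T))) := by
  refine (harris_ex_ind p (hup S) (hup T)).trans (ex_mono (fun ω => (isFKGMeasure_bernoulliWeight p).nonneg ω) fun ω => ?_)
  by_cases hω : ω ∈ G S ∩ G T
  · rw [ind_of_mem hω, ind_of_mem (hG S T hω)]
  · rw [ind_of_not_mem hω]; exact ind_nonneg _ ω

/-- **`F(k) ⇒ (GH)_k`**: if the relaxation `PhiNonneg k` holds then every normalised G-system of order `k` on every finite product space has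
`Φ_k(β) ≥ 0`. [this work] -/
theorem phiSet_gsystem_nonneg_of_phiNonneg (h : PrincipalCapBeta.PhiNonneg k) (p : ι → unitInterval)
    (G : Finset (Fin k) → Set (Set ι)) (hup : ∀ S, IsUpperSet (G S)) (hG : ∀ S T, G S ∩ G T ⊆ G (S ∪ T)) (htop : G univ = Set.univ) :
    0 ≤ phiSet k (fun S => ex (bernoulliWeight p) (ind (G S))) :=
  h _ (fun S => gsystem_nonneg p G S) (fun S => gsystem_le_one p G S) (gsystem_univ p G htop) (gsystem_supermul p G hup hG)

/-- **`(GH)_k` for `3 ≤ k ≤ 7`** (every finite product space, every normalised G-system): from the kernel theorems `F(3),…,F(7)`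
(`PrincipalCapBeta.phiNonneg_three/four/five/six`, `PhiCert.phiNonneg_seven`). [this work] -/
theorem phiSet_gsystem_nonneg_of_le_seven (h3 : 3 ≤ k) (h7 : k ≤ 7) (p : ι → unitInterval)
    (G : Finset (Fin k) → Set (Set ι)) (hup : ∀ S, IsUpperSet (G S)) (hG : ∀ S T, G S ∩ G T ⊆ G (S ∪ T)) (htop : G univ = Set.univ) :
    0 ≤ phiSet k (fun S => ex (bernoulliWeight p) (ind (G S))) := by
  interval_cases k
  · exact phiSet_gsystem_nonneg_of_phiNonneg PrincipalCapBeta.phiNonneg_three p G hup hG htop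
  · exact phiSet_gsystem_nonneg_of_phiNonneg PrincipalCapBeta.phiNonneg_four p G hup hG htop
  · exact phiSet_gsystem_nonneg_of_phiNonneg PrincipalCapBeta.phiNonneg_five p G hup hG htop
  · exact phiSet_gsystem_nonneg_of_phiNonneg PrincipalCapBeta.phiNonneg_six p G hup hG htop
  · exact phiSet_gsystem_nonneg_of_phiNonneg PhiCert.phiNonneg_seven p G hup hG htop

/-- **The one-missing-face inequalities of a G-system**: `Σ_{i∈B} β_{B∖i} ≤ 1 + (|B|−1)·β_B` (no monotonicity and no product structure needed:
the union property alone, averaged — `PhiNotEvent.sum_ex_indicator_erase_le`). [this work] -/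
theorem gsystem_face (p : ι → unitInterval) (G : Finset (Fin k) → Set (Set ι)) (hG : ∀ S T, G S ∩ G T ⊆ G (S ∪ T))
    (B : Finset (Fin k)) :
    ∑ i ∈ B, ex (bernoulliWeight p) (ind (G (B.erase i))) ≤
      1 + ((B.card : ℝ) - 1) * ex (bernoulliWeight p) (ind (G B)) := by
  set 𝒢 : Set ι → Finset (Finset (Fin k)) := fun ω => univ.filter fun S => ω ∈ G S with h𝒢
  have hUC : ∀ ω, ∀ A ∈ 𝒢 ω, ∀ A' ∈ 𝒢 ω, A ∪ A' ∈ 𝒢 ω := by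
    intro ω A hA A' hA'
    simp only [h𝒢, mem_filter, mem_univ, true_and] at hA hA' ⊢
    exact hG A A' ⟨hA, hA'⟩
  have hind : ∀ S : Finset (Fin k), ind (G S) = fun ω => if S ∈ 𝒢 ω then (1 : ℝ) else 0 := by
    intro S; funext ω
    by_cases hω : ω ∈ G S
    · rw [ind_of_mem hω, if_pos (by simp only [h𝒢, mem_filter, mem_univ, true_and]; exact hω)]
    · rw [ind_of_not_mem hω, if_neg (by simp only [h𝒢, mem_filter, mem_univ, true_and]; exact hω)]
  simp only [hind]
  exact PhiNotEvent.sum_ex_indicator_erase_le (bernoulliWeight p) (fun ω => (isFKGMeasure_bernoulliWeight p).nonneg ω)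
    (isFKGMeasure_bernoulliWeight p).sum_eq_one 𝒢 hUC B

/-- **No G-system of order 16 realises the witness against `F(16)`** (kernel form of "¬F(16) is not a Sahi counterexample"). [this work] -/
theorem gsystem_ne_f16 (p : ι → unitInterval) (G : Finset (Fin 16) → Set (Set ι)) (hG : ∀ S T, G S ∩ G T ⊆ G (S ∪ T)) :
    ¬ ∀ S : Finset (Fin 16), ex (bernoulliWeight p) (ind (G S)) = PhiSymmetric.f16 S.card := by
  set 𝒢 : Set ι → Finset (Finset (Fin 16)) := fun ω => univ.filter fun S => ω ∈ G S with h𝒢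
  have hUC : ∀ ω, ∀ A ∈ 𝒢 ω, ∀ A' ∈ 𝒢 ω, A ∪ A' ∈ 𝒢 ω := by
    intro ω A hA A' hA'
    simp only [h𝒢, mem_filter, mem_univ, true_and] at hA hA' ⊢
    exact hG A A' ⟨hA, hA'⟩
  have hind : ∀ S : Finset (Fin 16), ind (G S) = fun ω => if S ∈ 𝒢 ω then (1 : ℝ) else 0 := by
    intro S; funext ω
    by_cases hω : ω ∈ G S
    · rw [ind_of_mem hω, if_pos (by simp only [h𝒢, mem_filter, mem_univ, true_and]; exact hω)]
    · rw [ind_of_not_mem hω, if_neg (by simp only [h𝒢, mem_filter, mem_univ, true_and]; exact hω)]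
  intro h
  refine PhiNotEvent.f16_not_momentFunction (bernoulliWeight p) (fun ω => (isFKGMeasure_bernoulliWeight p).nonneg ω)
    (isFKGMeasure_bernoulliWeight p).sum_eq_one 𝒢 hUC fun S => ?_
  rw [← hind S]
  exact h S

end GSystems

end Summit.CriticalPhenomena.PercolationContinuityZ3.Theorems
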